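import Mathlib
import Summits.AtomisticToContinuum.HydrodynamicLimit.Theorems.ImplosionDichotomyDenseExcursionR2Modes
import Summits.AtomisticToContinuum.HydrodynamicLimit.Theorems.ImplosionDichotomyDenseExcursionR2EosData

/-!
# The `(m, J) = (1, 2)` spectral package and the tuned-packing target of the line `r2-one-mode-two-conditions`
# (crux `DenseExcursion`, stmt-AtomisticToContinuum-12586) — the two open stub STATEMENTS as importable vocabulary

Definitions file (`--supports stmt-AtomisticToContinuum-12586`, lead c3) for the line `r2-one-mode-two-conditions`
(skeleton v7, `Cruxes/DenseExcursion/Lines/r2_one_mode_two_conditions.lean`) of the crux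
`Summit.AtomisticToContinuum.HydrodynamicLimit.Theses.ImplosionDichotomy.DenseExcursion`.

After v7 the skeleton is `DenseExcursion_of : DenseExcursion` modulo exactly TWO registered stubs, both campaign-sized:
the certified-numerics input `stub_spectralPackage` (every globally smooth monatomic profile in the BCG window has the
`(1, 2)` package) and the heart `stub_tunedForcedImplosion` (such a profile forces tuned packing). Their statements use
three notions that so far lived only in the (non-importable) skeleton workfile; this file lands them VERBATIM so that the
seats working either stub can state and land their theorems against the tree:

* `IsGeneralizedMode r W S Λ ŵ₁ ŝ₁ ŵ₂ ŝ₂` — a centre-regular smooth solution of `(L - Λ)(ŵ₂, ŝ₂) = (ŵ₁, ŝ₁)` (a Jordan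
  chain vector over the mode `(ŵ₁, ŝ₁)`); its non-existence is algebraic simplicity of `Λ`;
* `OneModeTwoConditions r W S` — the `(m, J) = (1, 2)` PACKAGE: `IsMonatomicProfile r W S` and a real smooth radial mode
  `Λ₁ ∈ (6(r-1), 9(r-1))` (i.e. `2μ < Λ₁ < 3μ` for the packing clock `μ = 3(r-1)`), algebraically simple, such that the
  smooth radial point spectrum in `Re Λ > 0` is `{Λ₁, r}` (`Λ = r` is the blow-up-time gauge mode,
  `gauge_isSmoothRadialMode`). Numerics on record (five codes, crux dir `RaceResults.md`, `NOTES*.md`): at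
  `r₂ = 1.11281614862801…`, `Λ₁ = 0.79711291…`, `6(r₂-1) = 0.677 < Λ₁ < 9(r₂-1) = 1.015`;
* `TunedPacking` — LITERALLY the right-hand side of `denseExcursion_iff_eosData` (`…R2EosData.lean`): the flow-free
  crux (`tunedPacking_iff_denseExcursion`).

Plus the bookkeeping that makes the reduction citable from the tree: `denseExcursion_of_package_of_tuning` — the crux
follows from (i) a profile in the BCG window with its original-form equations (PROVED: `stub_profileEqs` and the BCG fact,
now a theorem via the 32 certified windows), (ii) the package for every such profile, (iii) tuned packing from the package.

Sources: Biasi 2021 §3 (smooth radial modes, `(m, J)` counting), Merle–Raphaël–Rodnianski–Szeftel 2022,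
Buckmaster–Cao-Labora–Gómez-Serrano 2025 Thm 1.1. NOT here: any proof of (ii) or (iii).
-/

noncomputable section

open Set Filter Topology

namespace Summit.AtomisticToContinuum.HydrodynamicLimit.Theorems.R2OneModeTwoConditions

open Literature.MathematicalPhysics.KineticTheory (T3 V3 IsHardSphereEulerSolution)
open Summit.AtomisticToContinuum.HydrodynamicLimit.Theses.ImplosionDichotomy (DenseExcursion)

/-! ## The line-posited definitions (verbatim: skeleton `r2_one_mode_two_conditions.lean` v7, §0) -/

/-- A GENERALISED (Jordan) smooth radial mode over the mode `(ŵ₁, ŝ₁)` at `Λ`: a centre-regular smooth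
solution of `(L - Λ)(ŵ₂, ŝ₂) = (ŵ₁, ŝ₁)` for the radial linearised operator `L = (linW, linS)` of the profile
`(W, S)`. Its non-existence (for a mode `(ŵ₁, ŝ₁)`) is algebraic simplicity of the eigenvalue `Λ`.
(Biasi 2021 §3; Merle–Raphaël–Rodnianski–Szeftel 2022.) -/
def IsGeneralizedMode (r : ℝ) (W S : ℝ → ℝ) (Λ : ℂ) (ŵ₁ ŝ₁ ŵ₂ ŝ₂ : ℝ → ℂ) : Prop :=
  IsRegularPair ŵ₂ ŝ₂ ∧
    ∀ x, Λ * ŵ₂ x + ŵ₁ x = linW r W S ŵ₂ ŝ₂ x ∧ Λ * ŝ₂ x + ŝ₁ x = linS r W S ŵ₂ ŝ₂ x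

/-- THE `(m, J) = (1, 2)` PACKAGE of the line `r2-one-mode-two-conditions`: a globally smooth monatomic profile
whose smooth radial point spectrum in `Re Λ > 0` consists of the symmetry (gauge) mode `Λ = r` and EXACTLY ONE
genuine unstable mode `Λ₁`, real and algebraically simple, with `2μ < Λ₁ < 3μ` for the packing clock
`μ = 3 (r - 1)` — so that an untuned `σ³`-seed and a `σ⁶`-seed of the unstable coordinate are both amplified to
`O(1)` before a fixed packing `η` while a `σ⁹`-seed is not: two tuning conditions, one unstable direction.
Computed at `r₂ ≈ 1.1128162`: `Λ₁ ≈ 0.79711 ∈ (6(r₂-1), 9(r₂-1)) = (0.677, 1.015)` (Biasi 2021 §3; five codes in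
the crux directory). -/
def OneModeTwoConditions (r : ℝ) (W S : ℝ → ℝ) : Prop :=
  IsMonatomicProfile r W S ∧
  ∃ Λ₁ : ℝ, 6 * (r - 1) < Λ₁ ∧ Λ₁ < 9 * (r - 1) ∧
    (∃ ŵ ŝ : ℝ → ℂ, IsSmoothRadialMode r W S (Λ₁ : ℂ) ŵ ŝ) ∧
    (∀ ŵ₁ ŝ₁ : ℝ → ℂ, IsSmoothRadialMode r W S (Λ₁ : ℂ) ŵ₁ ŝ₁ →
      ∀ ŵ₂ ŝ₂ : ℝ → ℂ, ¬ IsGeneralizedMode r W S (Λ₁ : ℂ) ŵ₁ ŝ₁ ŵ₂ ŝ₂) ∧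
    ∀ Λ : ℂ, 0 < Λ.re → (∃ ŵ ŝ : ℝ → ℂ, IsSmoothRadialMode r W S Λ ŵ ŝ) →
      Λ = (Λ₁ : ℂ) ∨ Λ = (r : ℂ)

/-- TUNED PACKING — the conclusion asked of the heart `stub_tunedForcedImplosion`; LITERALLY the right-hand side of
`denseExcursion_iff_eosData`, i.e. the flow-free form of the crux: there are `η > 0` and `σ`-INDEPENDENT continuous
positive profiles `(a₀, u₀, θ₀)` such that along a sequence `σ → 0` the classical hard-sphere Euler solution
(`p = ρθ Z(ρσ³)`) launched from an `EosRelated σ a₀` density `n` (= THE local-equilibrium density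
`rhoLim (profileOf a₀) σ = a₀/∫a₀ + O(σ³)`, `eosRelated_unique` / `eosRelated_rhoLim`) with velocity `u₀` and
temperature `θ₀` reaches packing `η`. In the line it is realised by the twice-tuned seed of `SS(r₂)` (`K₁ = K₂ = 0` on
knob × stable direction). -/
def TunedPacking : Prop :=
  ∃ η : ℝ, 0 < η ∧ ∃ (a₀ θ₀ : T3 → ℝ) (u₀ : T3 → V3), Continuous a₀ ∧ Continuous θ₀ ∧ Continuous u₀ ∧
    (∀ x, 0 < a₀ x) ∧ (∀ x, 0 < θ₀ x) ∧ ∀ σ₀ : ℝ, 0 < σ₀ → ∃ σ : ℝ, 0 < σ ∧ σ < σ₀ ∧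
      ∃ n : T3 → ℝ, EosRelated σ a₀ n ∧
        ∃ (T : ℝ) (ρ θ : ℝ → T3 → ℝ) (u : ℝ → T3 → V3), IsHardSphereEulerSolution σ T ρ u θ ∧
          ρ 0 = n ∧ u 0 = u₀ ∧ θ 0 = θ₀ ∧ ∃ t ∈ Set.Ico 0 T, ∃ x, η ≤ ρ t x * σ ^ 3

/-! ## Bookkeeping -/

/-- `TunedPacking` IS the crux in flow-free form: immediate from `denseExcursion_iff_eosData`. -/
theorem tunedPacking_iff_denseExcursion : TunedPacking ↔ DenseExcursion :=
  denseExcursion_iff_eosData.symm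

/-- A profile with the `(1, 2)` package is in particular a globally smooth monatomic profile. -/
theorem OneModeTwoConditions.isMonatomicProfile {r : ℝ} {W S : ℝ → ℝ} (h : OneModeTwoConditions r W S) :
    IsMonatomicProfile r W S :=
  h.1

/-- The unstable rate of the package is positive: `Λ₁ > 6(r - 1) > 0` since a monatomic profile has `r > 1`. -/
theorem OneModeTwoConditions.exists_pos_rate {r : ℝ} {W S : ℝ → ℝ} (h : OneModeTwoConditions r W S) :
    ∃ Λ₁ : ℝ, 0 < Λ₁ ∧ 6 * (r - 1) < Λ₁ ∧ Λ₁ < 9 * (r - 1) ∧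
      ∃ ŵ ŝ : ℝ → ℂ, IsSmoothRadialMode r W S (Λ₁ : ℂ) ŵ ŝ := by
  obtain ⟨hP, Λ₁, h6, h9, hmode, -, -⟩ := h
  have hr : 1 < r := hP.1
  exact ⟨Λ₁, by linarith, h6, h9, hmode⟩

/-- THE REDUCTION OF THE CRUX TO THE TWO OPEN STATEMENTS (skeleton v7 composition, citable form): `DenseExcursion`
follows from (i) a globally smooth monatomic profile in the BCG window `11/10 < r < 227/200` with its two profile
equations in original form, (ii) the `(1, 2)` package for every such profile (`stub_spectralPackage`), (iii) tuned
packing from the package (`stub_tunedForcedImplosion`). In the tree (i) is PROVED (`stub_profileEqs` applied to the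
BCG profile theorem, itself a theorem via the 32 certified left-barrier windows), so the crux is EXACTLY (ii) + (iii). -/
theorem denseExcursion_of_package_of_tuning
    (hprofile : ∃ (r : ℝ) (W S : ℝ → ℝ), (11 / 10 < r ∧ r < 227 / 200) ∧ IsMonatomicProfile r W S ∧
      ∀ x, (W x - 1) * deriv W x + 3 * S x * deriv S x = r * W x - W x ^ 2 - 3 * S x ^ 2 ∧
        (1 - W x) * deriv S x - S x / 3 * deriv W x = S x * (2 * W x - r))
    (hpkg : ∀ (r : ℝ) (W S : ℝ → ℝ), 11 / 10 < r → r < 227 / 200 → IsMonatomicProfile r W S →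
      (∀ x, (W x - 1) * deriv W x + 3 * S x * deriv S x = r * W x - W x ^ 2 - 3 * S x ^ 2 ∧
        (1 - W x) * deriv S x - S x / 3 * deriv W x = S x * (2 * W x - r)) →
      OneModeTwoConditions r W S)
    (htune : ∀ (r : ℝ) (W S : ℝ → ℝ), 11 / 10 < r → r < 227 / 200 →
      (∀ x, (W x - 1) * deriv W x + 3 * S x * deriv S x = r * W x - W x ^ 2 - 3 * S x ^ 2 ∧
        (1 - W x) * deriv S x - S x / 3 * deriv W x = S x * (2 * W x - r)) →
      OneModeTwoConditions r W S → TunedPacking) :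
    DenseExcursion := by
  obtain ⟨r, W, S, ⟨hr₁, hr₂⟩, hprof, heqs⟩ := hprofile
  exact tunedPacking_iff_denseExcursion.mp (htune r W S hr₁ hr₂ heqs (hpkg r W S hr₁ hr₂ hprof heqs))

end Summit.AtomisticToContinuum.HydrodynamicLimit.Theorems.R2OneModeTwoConditions

end
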